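import Summits.QuantumFields.BalabanUV.T4Continuum.Spine.NE1p.DressedSmallFieldComponentInner
import Summits.QuantumFields.BalabanUV.T4Continuum.Spine.NE1p.DressedSmallFieldNestedTori
import Summits.QuantumFields.BalabanUV.T4Continuum.Spine.NE1p.DressedSmallFieldInnerLink

/-!
# T⁴ programme, spine estimate NE1′ (node O3b/H2) — THE WHOLE (B3-count) CHAIN ON pv22's NESTED TORI WITH EVERY GEOMETRIC BINDER
# SUPPLIED: S41 PART 2's `attachedPart_locE_le_of_coresAt_pencil_components_inner` (N0s → N0u → N0v → N0w composed, `hinner` from N0u)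
# fired ON `tsys 4 (L·N′)` (scale k) ⊂ `tsys 4 N′` (scale k+1, the SAME torus blocked by `L`) with N0u's link by `link_torus` (fine torus,
# `c₃₂ = 5`), N0v's link by `link_torus'` (coarse torus, `c′ = 5`), closure `tclosureDom`, transfer `ineq236With_torus`, anchor at the
# canonical cell — NO geometry hypothesis, NO link binder, NO shape binder, NO selector; [Balaban1988RGII] pp. 17–20 KIND

Cell `pub-balaban`, sub-cell `t4`, BINDER-OWNERS row NE1′ (owner lineage t4-ne1p-p1, road P1 «RG-trajectory comparison … μ-uniformity
through the printed small-field bounds»); crew seat `b2b-balaban-t4-ne1p-formalise-leaf-01` (LEAF PROVER 01, generation 14); crew S-row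
S51 ∕ DAG N29zzzp «S41.2 ∘ S44 ∘ S40.1» (the g13 HANDOFF's follow-up (ii); INTENT + PROTOTYPE `CLAIMS.log` 2026-08-20 l.21799, BOOKED
typer R-T136 l.21867, STAGED & READY l.21877; X191 its read).  ADDITIVE — imports this lineage's S41 PART 2
`Spine/NE1p/DressedSmallFieldComponentInner` (→ S41 PART 1 → the owner's N0w `DressedSmallFieldComponentCount` → N0v → N0u → N0t → N0s →
…), this lineage's S44 `Spine/NE1p/DressedSmallFieldNestedTori`
(→ pv22 gen 3's [cite]-tagged `Literature/…/TreeLengthTorusGeometry236` → `TreeLengthTorusTransfer`, S24 `DressedSmallFieldGeometryFaces`)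
and crew leaf-07's S40.1 `Spine/NE1p/DressedSmallFieldInnerLink` (→ N0u, S24) ONLY; THEOREMS ONLY (0 `def`, 0 `def … : Prop`, 0 cite);
nothing of N0s–N0w ∕ S41 ∕ S44 ∕ S40 ∕ S24 ∕ N0o ∕ pv22 is restated — `attachedPart_locE_le_of_coresAt_pencil_components_inner`,
`…_componentSets_inner`, `exists_mem_anchor`, `card_anchor_le`, `link_torus`, `link_torus'`, `ineq236With_torus`, `torus_consts`, `K₀_four`
are used BY NAME.

WHY THIS FILE.  After S41 (N0u's inner count COMPOSED into N0w's END: `hinner` gone, over ABSTRACT geometries `G`∕`Gk` with the links,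
the closure, the anchor and the (2.36) transfer displayed) and S44 (N0w's END on pv22's nested tori: closure ∕ transfer ∕ anchor
CONSTRUCTED, but `hinner`, both links and a cell selector displayed) the riders of record still read, for every two-scale face, one of
«`hinner` SHAPE displayed», «links displayed — S40 discharges them on unit-cube geometries, composable, not imported», «selector `bsel`
displayed».  On ONE object all of them go at once: pv22's nested tori ARE unit-cube geometries at both scales (S40.1 §2: a single cube is
a torus localization domain of tree length 0, so (2.27) on the augmented family gives the link at `5`, uniformly in `N` and `d`), the
closure of a fine component is a torus domain hence NON-EMPTY (its canonical cell `Classical.choose Z′.2.1` anchors it — no selector),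
and S41.2's composed END accepts S44's closure ∕ transfer ∕ anchor suppliers verbatim.  This file is that junction:
* §1 [folklore]: `exists_mem_anchor_choose` — S44 §3 `exists_mem_anchor` at the canonical cell of `tclosureDom L N′ Z₀`;
  `card_anchor_choose_le` — S44 §3 `card_anchor_le` there (`≤ 3^d·L^d`).
* §2 END **`attachedPart_locE_le_of_coresAt_pencil_components_inner_nestedTori`** — S41.2's single END ONCE BY NAME at
  `D := tsys 4 N′`, `G := tgeometry 4 N′`, `Dk := tsys 4 (L·N′)`, `Gk := tgeometry 4 (L·N′)` with `hlinkk := link_torus 4 (L·N′)`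
  (`c₃₂ := 5`), `hlink := link_torus' 4 N′` (`c′ := 5`), `cl := tclosureDom L N′`, `htransfer := ineq236With_torus L N′ hL`
  (`ℓ := L∕a236 L`, `3 ≤ L`), `anc Z′ :=` the fine cubes whose □̃ coarsens onto `Classical.choose Z′.2.1` (`Aₐ := 3⁴·L⁴`, §1), the
  (2.29)∕step clauses AS LOCATED NUMERALS AT BOTH SCALES (N0o `torus_consts` read at `N′` AND at `L·N′` + S24 `K₀_four`); conclusion
  LITERALLY the crew torus currency at the COARSE torus `4·(e·9·64·K₀(64,8)²)·A₁·e^{−r₁·torusTreeLen X₀}` (= S44's, byte for byte);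
  END **`attachedPart_locE_le_of_coresAt_pencil_componentSets_inner_nestedTori`** — S41.2's SET-VALUED END (print p. 19: n ≥ 1
  components determining `Z′_i`) ONCE BY NAME with the same supplies.

PRINTED LOCI (TYPE ∕ CONTEXT only — [Balaban1988RGII] = CMP 116 (1988) pp. 17–20, quoted VERBATIM in the imported owner ∕ S44 ∕ S40
headers from the renders `b2b-balaban-ref1/pages/1988-cmp116-rg-II-cluster/…-p017…p020-x2.png`; nothing below is used as a fact about
Bałaban's densities): p. 18 (2.27) «d_k(Z₀) + 5 ≤ Σ (d_k(Y) + 5) …», (2.32); p. 19 «For each Z′_i we sum over all possible components of Z₀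
determining this Z′_i … 2d_k(Z_i) ≥ Ld_{k+1}(Z′_i). (2.36)», (2.37); p. 20 «… with an additional sum over (L+2)⁴ cubes □′ from π_k, the
cubes touching a fixed LM-cube in Z′_i», «The inequality (2.27) is used for the remaining exponential factors».
WHAT STAYS DISPLAYED (binders, by name; NOTHING instantiated on Bałaban's densities): the room, operator conditions, class radii; (B1b)'s
residue `terms`∕`emb`∕`hscale`∕`hact` and `hadm` (inner data of a member `Z′` = components `Z₀` of the FINE torus with `tclosureDom L N′ Z₀
= Z′`, each carrying one of N0u's admissible labels `⟨W, (𝐃, P)⟩` WRITTEN OUT — one, resp. a nonempty set; (B1b)∕(2.35) READING); N0u's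
bonds-per-cube letter `bondsOf`∕`hb₀` and table letters `δ κ α₆ R_k b₀ s t`; (B3-amp) `hAmp` — THE place where the dressed table radius
enters, p. 18's clause KIND at `C₃(E₀ + D₀)`, NOT asserted; the located clauses «κ large» `64·log 162 + 1 ≤ δκ`, `64·log 162 + 1 ≤ r`,
`r₁ + 2·(64·log 162) + 2 ≤ Rkp`, «α₆∕ε₁ small» `e·K₀(64,8)·64·α₆ ≤ 1`, `e·K₀(64,8)·64·(ε·e^{64u_k − 5R_k}·3⁴L⁴·K₀(64,8)·e^{5R}) ≤ 1`
(times `e^{A}` for sets), `(A₀+ϱA₁)·e^{5r₁+1}·K₀(64,8)·9·64 ≤ 1`, and the rate bookkeeping `64·log 162 ≤ R_k − 64u_k`,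
`r + R ≤ (R_k − 64u_k − 64·log 162)·(L∕a236 L)`, `Rkp ≤ R − 64·v·e^{5R}`, `u_k := e^{5R_k}·s·e^{b₀t}`, `3 ≤ L` — (B5)-KIND bookkeeping on
displayed letters whose standing against print's δ, κ, κ₁, α₆, L, M is NOT asserted.  WHAT IT SAYS FOR THE WALL (the owner's reading,
wall v1.8 of record, T4-DAG v48 §6 NE1; nothing re-labelled here): (B3-count) = the 𝐃-step (N0s), the Y₀∕P-step (N0u), the
components-and-{Z′_i}-step (N0w ∘ N0v) and the Z∖Z′₀-step (N0v) as ONE kernel implication on pv22's CONSTRUCTED nested tori with NO item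
«of printed KIND» left displayed among the links ∕ (2.36) transfer ∕ anchor ∕ closure — all four are KERNEL there (the links by (2.27) on
the augmented family, S40.1; the transfer by pv22's [cite]-tagged substitute of the unproved printed (2.36), G-B13-09R; the anchor by S44);
what remains is READING (`hadm`, the identification of `tsys`∕`torusTreeLen`∕`tclosureDom` with Bałaban's 𝐃_k ⊂ 𝐃_{k+1} ∕ d_k ∕ Z′ —
pv22's D-pv22.3 ∕ D-pv22g2.1 ∕ D-pv22g3.1, asserted nowhere), (B3-amp) `hAmp` and (B5)-KIND arithmetic.  NOTHING of (B3) discharged on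
Bałaban's (2.14) densities; 0 binders instantiated on Bałaban's densities; no wall item moves; wall v1.8 (T4-DAG v48) — words, not kind —
does NOT move; R-t4r2-Q2 NOT met thereby; NE1′ ⇐ the named binders — ONE label NEW ∕ NOT PRINTED ∕ NOT PROVED; spine PROVED 0∕9; count 9
unchanged.
HONEST FRAMING.  By-name composition of LANDED kernel theorems over binder SHAPES; the cores ∕ labels are the cell's typed FORMAT of
(2.14) and of the resummation index, NOT Bałaban's functions; the located numerals are pv22's PROVED constants; print's ½L, (L+2)⁴ and
(2.32)'s 4 are TYPE∕CONTEXT — ℓ = L∕a236 L, 3⁴·L⁴ and 5 are the tree's objects (S40.1 `link_torus_const_sharp`: 5 is sharp AS TYPED);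
N0s∕N0u's `foot`∕`hmono` (the REFINEMENT direction, crew rows S43∕S48) are NOT in this file; ABSOLUTE RULE honoured — nothing internally
minted is cited, [folklore] tags on kernel theorems only.  Rung (B)+1 on ONE finite four-torus — NOT infinite volume, NOT a mass gap,
NOT OS on ℝ⁴, NOT Clay.  HONEST DEPENDENCY: continuum YM on T⁴ ⇐ BetaPertH ∧ nine spine estimates (0/9 proved); BetaPertH ⇐ (D1) ∧ (D4)
∧ CAP+tail; G-an2-4 gates asym, D1 and NE2/3/4.
-/

noncomputable section

namespace Summit.QuantumFields.BalabanUV.T4Continuum.NE1p.DressedSmallFieldComponentInnerNestedTori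

open Metric Set Complex MeasureTheory
open scoped BigOperators
open Literature.MathematicalPhysics.QuantumFieldTheory.Balaban1983to89
open Literature.MathematicalPhysics.QuantumFieldTheory.Balaban1983to89.B13ScaleTransfer (Pt block coarse)
open Literature.MathematicalPhysics.QuantumFieldTheory.Balaban1983to89.B13FamilySum (coveringFamilies)
open Literature.MathematicalPhysics.QuantumFieldTheory.Balaban1983to89.T4OutputRate (Carriers)
open Literature.MathematicalPhysics.QuantumFieldTheory.Balaban1983to89.B13Resummation (locE Geometry)
open Literature.MathematicalPhysics.QuantumFieldTheory.Balaban1983to89.TreeLengthTorus (TPt proj natLift tsys TDom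
  torusTreeLen)
open Literature.MathematicalPhysics.QuantumFieldTheory.Balaban1983to89.TreeLengthTorusGeometry (TTouch tgeometry)
open Literature.MathematicalPhysics.QuantumFieldTheory.Balaban1983to89.TreeLengthTorusTransfer (tclosureDom)
open Literature.MathematicalPhysics.QuantumFieldTheory.Balaban1983to89.TreeLengthTorusGeometry236 (ineq236With_torus)
open Literature.MathematicalPhysics.QuantumFieldTheory.Balaban1983to89.B12TreeDecay (K₀)
open Literature.MathematicalPhysics.QuantumFieldTheory.Balaban1983to89.B13Geometry236 (a236)
open Summit.QuantumFields.BalabanUV.T4Continuum.B13HistMeasurable (MeasPotFrame B13HistM)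
open Summit.QuantumFields.BalabanUV.T4Continuum.B13TermParamGaussianBi (BiCore)
open Summit.QuantumFields.BalabanUV.T4Continuum.NE1p.DressedSmallFieldGeometry (torus_consts)
open Summit.QuantumFields.BalabanUV.T4Continuum.NE1p.DressedSmallFieldGeometryFaces (K₀_four)
open Summit.QuantumFields.BalabanUV.T4Continuum.NE1p.DressedSmallFieldInnerLink (link_torus link_torus')
open Summit.QuantumFields.BalabanUV.T4Continuum.NE1p.DressedSmallFieldNestedTori (exists_mem_anchor card_anchor_le)
open Summit.QuantumFields.BalabanUV.T4Continuum.NE1p.DressedSmallFieldComponentInner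
  (attachedPart_locE_le_of_coresAt_pencil_components_inner attachedPart_locE_le_of_coresAt_pencil_componentSets_inner)

/-! ## §1 The anchor at the canonical cell of a member (no selector binder) -/

section Anchor

variable {d L N' : ℕ} [NeZero L] [NeZero N']

/-- **ANCHOR AT THE CANONICAL CELL** (S44 §3 `exists_mem_anchor` at the cell `Classical.choose Z′.2.1` of the member `Z′ = cl Z₀` —
a torus localization domain is non-empty by definition (`IsTDom`), so NO selector binder is needed): some cube of the fine
component `Z₀` lies in the anchor set of that cell. [folklore] -/
theorem exists_mem_anchor_choose (Z₀ : (tsys d (L * N')).Dom) :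
    ∃ a ∈ (Finset.univ.filter fun a : TPt d (L * N') =>
        ∃ y ∈ block (natLift a), proj N' (coarse L y) = Classical.choose (tclosureDom L N' Z₀).2.1),
      a ∈ Z₀.1 := by
  classical
  obtain ⟨a, ha, y, hy, hyb⟩ := exists_mem_anchor Z₀ (Classical.choose_spec (tclosureDom L N' Z₀).2.1)
  exact ⟨a, Finset.mem_filter.2 ⟨Finset.mem_univ _, y, hy, hyb⟩, ha⟩

/-- … and the anchor set of the canonical cell of ANY member `Z′` of the coarse torus has at most `3^d·L^d` elements
(S44 §3 `card_anchor_le` BY NAME). [folklore] -/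
theorem card_anchor_choose_le (Z' : (tsys d N').Dom) :
    ((Finset.univ.filter fun a : TPt d (L * N') =>
        ∃ y ∈ block (natLift a), proj N' (coarse L y) = Classical.choose Z'.2.1).card : ℝ) ≤
      (3 : ℝ) ^ d * (L : ℝ) ^ d := by
  classical
  exact card_anchor_le (d := d) (Classical.choose Z'.2.1)

end Anchor

/-! ## §2 THE ENDs ON THE NESTED TORI WITH EVERY GEOMETRIC BINDER OF THE FOUR RESUMMATION STEPS SUPPLIED -/

section End

variable {L N' : ℕ} [NeZero L] [NeZero N'] {Bnd : Type} [DecidableEq Bnd]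
variable {C : Carriers} {P : MeasPotFrame C} {Op : Type*} [NormedAddCommGroup Op] [NormedSpace ℂ Op]

section Single

variable
  {𝒴 : ℕ → (Σ _ : Finset (TPt 4 N'), Σ F : Finset (tsys 4 N').Dom, ∀ Z ∈ F,
    (Σ _ : (tsys 4 (L * N')).Dom, (Σ _ : Finset (TPt 4 (L * N')), Finset (tsys 4 (L * N')).Dom × Finset Bnd))) → Type*}
  {dom : ∀ k i, 𝒴 k i → C.Dom}
  {β : ℕ → (Σ _ : Finset (TPt 4 N'), Σ F : Finset (tsys 4 N').Dom, ∀ Z ∈ F,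
    (Σ _ : (tsys 4 (L * N')).Dom, (Σ _ : Finset (TPt 4 (L * N')), Finset (tsys 4 (L * N')).Dom × Finset Bnd))) → Type*}
  [∀ k i, MeasurableSpace (β k i)]
  {α : ℕ → (Σ _ : Finset (TPt 4 N'), Σ F : Finset (tsys 4 N').Dom, ∀ Z ∈ F,
    (Σ _ : (tsys 4 (L * N')).Dom, (Σ _ : Finset (TPt 4 (L * N')), Finset (tsys 4 (L * N')).Dom × Finset Bnd))) → Type*}
  [∀ k i, NormedAddCommGroup (α k i)] [∀ k i, InnerProductSpace ℝ (α k i)] [∀ k i, FiniteDimensional ℝ (α k i)]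
  [∀ k i, MeasurableSpace (α k i)] [∀ k i, BorelSpace (α k i)]

open Classical in
/-- **THE WHOLE (B3-count) CHAIN ON THE NESTED TORI OF THE PAPERS — ONE COMPONENT PER MEMBER** (kernel; S41 PART 2's
`attachedPart_locE_le_of_coresAt_pencil_components_inner` ONCE BY NAME at `D := tsys 4 N′`, `G := tgeometry 4 N′` (scale k+1),
`Dk := tsys 4 (L·N′)`, `Gk := tgeometry 4 (L·N′)` (scale k, the SAME torus with `L·N′` cubes per direction), with EVERY geometric
binder of the four resummation steps SUPPLIED: N0u's (2.27)∘(2.32)-KIND link `hlinkk` by S40.1's `link_torus` at the FINE torus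
(`c₃₂ = 5`), N0v's (2.27)∘(2.37)-KIND link `hlink` by S40.1's `link_torus'` at the COARSE torus (`c′ = 5`), N0w's closure
`cl := tclosureDom L N′`, the (2.36)-KIND transfer `htransfer :=` pv22's `ineq236With_torus` (`ℓ = L∕a236 L`, `3 ≤ L`), the anchor
CONSTRUCTED at the canonical cell of each member (§1; `Aₐ := 3⁴·L⁴`) and N0w's inner-count SHAPE `hinner` by S41 PART 2 from N0u —
and the (2.29)∕step letters located at BOTH scales by N0o `torus_consts` + S24 `K₀_four`.  NO geometry hypothesis, NO link binder, NO
shape binder, NO selector.  STILL DISPLAYED: (B1b)'s residue `terms`∕`emb`∕`hscale`∕`hact` and `hadm` (READING), N0u's bonds-per-cube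
letter `bondsOf`∕`hb₀` and table letters `δ κ α₆ R_k b₀ s t`, (B3-amp) `hAmp`, the located clauses and the rate bookkeeping
`hκk`∕`h229k`∕`hκR`∕`hrate2`∕`hκ`∕`h229`∕`hrate`∕`hsmall`∕`hRR` ((B5)-KIND).  Conclusion = the crew torus currency at the COARSE
torus. [folklore] -/
theorem attachedPart_locE_le_of_coresAt_pencil_components_inner_nestedTori (hL : 3 ≤ L) {Win : Set (ℕ → ℝ)}
    {ctr : ℕ → (ℕ → ℝ) → C.BgB → Op × B13HistM P} {ROp RHist R' : ℕ → ℝ}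
    (𝔊 : ∀ k i, C.Dom → BiCore P (dom k i) Op (β k i) (α k i))
    {mq bq N₀ : ℕ → (Σ _ : Finset (TPt 4 N'), Σ F : Finset (tsys 4 N').Dom, ∀ Z ∈ F,
      (Σ _ : (tsys 4 (L * N')).Dom, (Σ _ : Finset (TPt 4 (L * N')), Finset (tsys 4 (L * N')).Dom × Finset Bnd))) →
      C.Dom → ℝ}
    (hroom : ∀ k, ROp k < R' k)
    (hm : ∀ k, ∀ g ∈ Win, ∀ (U : C.BgB) (X : C.Dom), C.scale X = k → ∀ i, 0 < mq k i X)
    (hN : ∀ k, ∀ g ∈ Win, ∀ (U : C.BgB) (X : C.Dom), C.scale X = k → ∀ i,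
      (∀ o ∈ ball (ctr k g U).1 (R' k), AEStronglyMeasurable ((𝔊 k i X).N o) (𝔊 k i X).lam) ∧
      (∀ p, DifferentiableOn ℂ (fun o => (𝔊 k i X).N o p) (ball (ctr k g U).1 (R' k))) ∧
      (∀ o ∈ ball (ctr k g U).1 (R' k), ∀ p, ‖(𝔊 k i X).N o p‖ ≤ N₀ k i X))
    (hq : ∀ k, ∀ g ∈ Win, ∀ (U : C.BgB) (X : C.Dom), C.scale X = k → ∀ i,
      (∀ o ∈ ball (ctr k g U).1 (R' k),
        AEStronglyMeasurable (Function.uncurry ((𝔊 k i X).q o)) ((𝔊 k i X).lam.prod volume)) ∧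
      (∀ p v, DifferentiableOn ℂ (fun o => (𝔊 k i X).q o p v) (ball (ctr k g U).1 (R' k))) ∧
      (∀ o ∈ ball (ctr k g U).1 (R' k), ∀ p v, mq k i X * ‖v‖ ^ 2 - bq k i X ≤ ((𝔊 k i X).q o p v).re))
    {k : ℕ} {g : ℕ → ℝ} (hg : g ∈ Win) {U : C.BgB} {o : Op} {h₀ w : B13HistM P} {ϱ : ℝ}
    (hO : ‖o - (ctr k g U).1‖ ≤ ROp k) (hH : ‖h₀ - (ctr k g U).2‖ + ϱ * ‖w‖ ≤ RHist k)
    {emb : (tsys 4 N').Dom → C.Dom} (hscale : ∀ Z, C.scale (emb Z) = k)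
    {terms : (tsys 4 N').Dom → Finset (Σ _ : Finset (TPt 4 N'), Σ F : Finset (tsys 4 N').Dom, ∀ Z ∈ F,
      (Σ _ : (tsys 4 (L * N')).Dom, (Σ _ : Finset (TPt 4 (L * N')), Finset (tsys 4 (L * N')).Dom × Finset Bnd)))}
    {act : ℂ → (tsys 4 N').Dom → ℂ}
    (hact : ∀ σ ∈ ball (0 : ℂ) ϱ, ∀ Z, act σ Z = ∑ i ∈ terms Z, (𝔊 k i (emb Z)).termAt o (h₀ + σ • w))
    {A₀ A₁ Rkp r₁ : ℝ} (X₀ : (tsys 4 N').Dom) (hA₀ : 0 ≤ A₀) (hA₁ : 0 ≤ A₁) (hr₁ : 0 ≤ r₁)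
    (hrate : r₁ + 2 * (64 * Real.log 162) + 2 ≤ Rkp)
    (hsmall : (A₀ + ϱ * A₁) * Real.exp (5 * r₁ + 1) * K₀ 64 8 * 9 * 64 ≤ 1)
    -- scale `k` (the fine torus): N0u's table letters and bonds-per-cube letter; the link is GONE (`c₃₂ = 5`, `link_torus`)
    (bondsOf : Finset (TPt 4 (L * N')) → Finset Bnd) {δ κ α₆ Rk b₀ s t : ℝ}
    (hα₆ : 0 ≤ α₆) (hκk : 64 * Real.log 162 + 1 ≤ δ * κ) (h229k : Real.exp 1 * K₀ 64 8 * 64 * α₆ ≤ 1)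
    (hs0 : 0 ≤ s) (hs1 : s ≤ 1) (ht : 0 ≤ t) (hb₀ : ∀ W, ((bondsOf W).card : ℝ) ≤ b₀ * W.card)
    -- scale `k+1` (the coarse torus): N0v's letters; closure ∕ anchor ∕ transfer ∕ link are GONE
    {ε r R v : ℝ} (hε : 0 ≤ ε) (hv : 0 ≤ v)
    (hκR : 64 * Real.log 162 ≤ Rk - 64 * (Real.exp (Rk * 5) * s * Real.exp (b₀ * t)))
    (hrate2 : r + R ≤ (Rk - 64 * (Real.exp (Rk * 5) * s * Real.exp (b₀ * t)) - 64 * Real.log 162) * ((L : ℝ) / a236 L))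
    (hκ : 64 * Real.log 162 + 1 ≤ r)
    (h229 : Real.exp 1 * K₀ 64 8 * 64 *
      (ε * Real.exp (64 * (Real.exp (Rk * 5) * s * Real.exp (b₀ * t)) - 5 * Rk) * ((3 : ℝ) ^ 4 * (L : ℝ) ^ 4) * K₀ 64 8 *
        Real.exp (5 * R)) ≤ 1)
    (hRR : Rkp ≤ R - 64 * (v * Real.exp (R * 5)))
    (hadm : ∀ Z : (tsys 4 N').Dom, ∀ l ∈ terms Z, l.1 ⊆ Z.1 ∧
      l.2.1 ∈ coveringFamilies Finset.univ (fun Y : (tsys 4 N').Dom => Y.1) (Z.1 \ l.1) ∧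
      ∀ Z' (h : Z' ∈ l.2.1), l.2.2 Z' h ∈
        ((Finset.univ : Finset (tsys 4 (L * N')).Dom).filter (fun Z₀ => tclosureDom L N' Z₀ = Z')).sigma fun Z₀ =>
          Z₀.1.powerset.sigma fun W =>
            coveringFamilies Finset.univ (fun Y : (tsys 4 (L * N')).Dom => Y.1) (Z₀.1 \ W) ×ˢ
              (bondsOf W).powerset.filter fun P => W.card ≤ 2 * P.card)
    (hAmp : ∀ Z : (tsys 4 N').Dom, Z.1 ⊆ X₀.1 → ∀ l ∈ terms Z,
      (𝔊 k l (emb Z)).lam.real univ * ((𝔊 k l (emb Z)).wB * N₀ k l (emb Z) * Real.exp (bq k l (emb Z))) *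
          (Real.pi / (mq k l (emb Z) / 2)) ^ (Module.finrank ℝ (α k l) / 2 : ℝ) *
        Real.exp ((𝔊 k l (emb Z)).N₁ * (‖h₀‖ + ϱ * ‖w‖)) ≤
      (A₀ + ϱ * A₁) * (v ^ l.1.card * ∏ x ∈ l.2.1.attach, (ε *
        ((∏ Y ∈ (l.2.2 x.1 x.2).2.2.1,
            (α₆ * Real.exp (-(δ * κ * torusTreeLen Y.1)) * Real.exp (-(Rk * (torusTreeLen Y.1 + 5))))) *
          (s ^ 2 * t) ^ (l.2.2 x.1 x.2).2.2.2.card))))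
    (hϱ : 2 ≤ ϱ) (hϱA : A₀ ≤ ϱ * A₁) :
    ‖locE (TTouch (d := 4) (N := N')) (fun Z : (tsys 4 N').Dom => Z.1) (act 1) X₀.1 -
        locE (TTouch (d := 4) (N := N')) (fun Z : (tsys 4 N').Dom => Z.1) (act 0) X₀.1‖ ≤
      4 * (Real.exp 1 * 9 * 64 * K₀ 64 8 ^ 2) * A₁ * Real.exp (-(r₁ * torusTreeLen X₀.1)) := by
  obtain ⟨hν, hκ₀, hc⟩ := torus_consts N'
  obtain ⟨-, hκ₀k, hck⟩ := torus_consts (L * N')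
  have hK₀ := K₀_four (N := N')
  have hK₀k := K₀_four (N := L * N')
  have htr := ineq236With_torus (d := 4) L N' hL
  have h := attachedPart_locE_le_of_coresAt_pencil_components_inner (tsys 4 N') (tgeometry 4 N') (tgeometry 4 (L * N')) 𝔊
    hroom hm hN hq hg hO hH hscale hact (Rkp := Rkp) (b₅ := 5 * r₁) (X₀ := X₀) hA₀ hA₁ hr₁ (le_of_eq (by ring))
    (by rw [hκ₀]; exact hrate) (by rw [hK₀, hν, hc]; exact hsmall) bondsOf (c₃₂ := 5) hα₆ (by rw [hκ₀k]; exact hκk)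
    (by rw [hK₀k, hck]; exact h229k) hs0 hs1 ht hb₀ (fun Z₀ W hW Df hDf => link_torus 4 (L * N') Z₀ W hW Df hDf)
    (tclosureDom L N')
    (fun Z' => Finset.univ.filter fun a : TPt 4 (L * N') =>
      ∃ y ∈ block (natLift a), proj N' (coarse L y) = Classical.choose Z'.2.1)
    (Aₐ := (3 : ℝ) ^ 4 * (L : ℝ) ^ 4) (ℓ := (L : ℝ) / a236 L) (c' := 5) hε hv
    (fun Z₀ Z' h => by subst h; exact exists_mem_anchor_choose Z₀)
    (fun Z' => card_anchor_choose_le (d := 4) (L := L) Z')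
    (fun Z₀ Z' h => by subst h; exact htr Z₀) (by rw [hκ₀k, hck]; exact hκR) (by rw [hκ₀k, hck]; exact hrate2)
    (by rw [hκ₀]; exact hκ) (by rw [hK₀, hc, hK₀k, hck]; exact h229) (fun Z W hW F hF => link_torus' 4 N' Z W hW F hF)
    (by rw [hc]; exact hRR) hadm hAmp hϱ hϱA
  rw [hν, hc, hK₀] at h
  exact h

end Single

section Sets

variable
  {𝒴 : ℕ → (Σ _ : Finset (TPt 4 N'), Σ F : Finset (tsys 4 N').Dom, ∀ Z ∈ F,
    Finset (Σ _ : (tsys 4 (L * N')).Dom, (Σ _ : Finset (TPt 4 (L * N')), Finset (tsys 4 (L * N')).Dom × Finset Bnd))) →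
    Type*}
  {dom : ∀ k i, 𝒴 k i → C.Dom}
  {β : ℕ → (Σ _ : Finset (TPt 4 N'), Σ F : Finset (tsys 4 N').Dom, ∀ Z ∈ F,
    Finset (Σ _ : (tsys 4 (L * N')).Dom, (Σ _ : Finset (TPt 4 (L * N')), Finset (tsys 4 (L * N')).Dom × Finset Bnd))) →
    Type*}
  [∀ k i, MeasurableSpace (β k i)]
  {α : ℕ → (Σ _ : Finset (TPt 4 N'), Σ F : Finset (tsys 4 N').Dom, ∀ Z ∈ F,
    Finset (Σ _ : (tsys 4 (L * N')).Dom, (Σ _ : Finset (TPt 4 (L * N')), Finset (tsys 4 (L * N')).Dom × Finset Bnd))) →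
    Type*}
  [∀ k i, NormedAddCommGroup (α k i)] [∀ k i, InnerProductSpace ℝ (α k i)] [∀ k i, FiniteDimensional ℝ (α k i)]
  [∀ k i, MeasurableSpace (α k i)] [∀ k i, BorelSpace (α k i)]

open Classical in
/-- **THE WHOLE (B3-count) CHAIN ON THE NESTED TORI OF THE PAPERS — A NONEMPTY SET OF COMPONENTS PER MEMBER** (kernel; print
p. 19's n ≥ 1 components determining `Z′_i`: S41 PART 2's `attachedPart_locE_le_of_coresAt_pencil_componentSets_inner` ONCE BY NAME
on the nested tori with the SAME supplies as `attachedPart_locE_le_of_coresAt_pencil_components_inner_nestedTori` (both links at `5`,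
closure `tclosureDom`, transfer `ineq236With_torus`, anchor at the canonical cell, `hinner` from N0u, letters at both scales located).
DISPLAYED as there, with `hadm`'s NONEMPTY-SUBSET clause, `hAmp`'s set-product majorant and N0v's (2.29) clause `h229` at PART 1's
amplitude `A·e^{5R}·e^{A}`, `A := ε·e^{64u_k − 5R_k}·3⁴L⁴·K₀(64,8)`, `u_k := e^{5R_k}·s·e^{b₀t}`. [folklore] -/
theorem attachedPart_locE_le_of_coresAt_pencil_componentSets_inner_nestedTori (hL : 3 ≤ L) {Win : Set (ℕ → ℝ)}
    {ctr : ℕ → (ℕ → ℝ) → C.BgB → Op × B13HistM P} {ROp RHist R' : ℕ → ℝ}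
    (𝔊 : ∀ k i, C.Dom → BiCore P (dom k i) Op (β k i) (α k i))
    {mq bq N₀ : ℕ → (Σ _ : Finset (TPt 4 N'), Σ F : Finset (tsys 4 N').Dom, ∀ Z ∈ F,
      Finset (Σ _ : (tsys 4 (L * N')).Dom, (Σ _ : Finset (TPt 4 (L * N')), Finset (tsys 4 (L * N')).Dom × Finset Bnd))) →
      C.Dom → ℝ}
    (hroom : ∀ k, ROp k < R' k)
    (hm : ∀ k, ∀ g ∈ Win, ∀ (U : C.BgB) (X : C.Dom), C.scale X = k → ∀ i, 0 < mq k i X)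
    (hN : ∀ k, ∀ g ∈ Win, ∀ (U : C.BgB) (X : C.Dom), C.scale X = k → ∀ i,
      (∀ o ∈ ball (ctr k g U).1 (R' k), AEStronglyMeasurable ((𝔊 k i X).N o) (𝔊 k i X).lam) ∧
      (∀ p, DifferentiableOn ℂ (fun o => (𝔊 k i X).N o p) (ball (ctr k g U).1 (R' k))) ∧
      (∀ o ∈ ball (ctr k g U).1 (R' k), ∀ p, ‖(𝔊 k i X).N o p‖ ≤ N₀ k i X))
    (hq : ∀ k, ∀ g ∈ Win, ∀ (U : C.BgB) (X : C.Dom), C.scale X = k → ∀ i,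
      (∀ o ∈ ball (ctr k g U).1 (R' k),
        AEStronglyMeasurable (Function.uncurry ((𝔊 k i X).q o)) ((𝔊 k i X).lam.prod volume)) ∧
      (∀ p v, DifferentiableOn ℂ (fun o => (𝔊 k i X).q o p v) (ball (ctr k g U).1 (R' k))) ∧
      (∀ o ∈ ball (ctr k g U).1 (R' k), ∀ p v, mq k i X * ‖v‖ ^ 2 - bq k i X ≤ ((𝔊 k i X).q o p v).re))
    {k : ℕ} {g : ℕ → ℝ} (hg : g ∈ Win) {U : C.BgB} {o : Op} {h₀ w : B13HistM P} {ϱ : ℝ}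
    (hO : ‖o - (ctr k g U).1‖ ≤ ROp k) (hH : ‖h₀ - (ctr k g U).2‖ + ϱ * ‖w‖ ≤ RHist k)
    {emb : (tsys 4 N').Dom → C.Dom} (hscale : ∀ Z, C.scale (emb Z) = k)
    {terms : (tsys 4 N').Dom → Finset (Σ _ : Finset (TPt 4 N'), Σ F : Finset (tsys 4 N').Dom, ∀ Z ∈ F,
      Finset (Σ _ : (tsys 4 (L * N')).Dom, (Σ _ : Finset (TPt 4 (L * N')), Finset (tsys 4 (L * N')).Dom × Finset Bnd)))}
    {act : ℂ → (tsys 4 N').Dom → ℂ}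
    (hact : ∀ σ ∈ ball (0 : ℂ) ϱ, ∀ Z, act σ Z = ∑ i ∈ terms Z, (𝔊 k i (emb Z)).termAt o (h₀ + σ • w))
    {A₀ A₁ Rkp r₁ : ℝ} (X₀ : (tsys 4 N').Dom) (hA₀ : 0 ≤ A₀) (hA₁ : 0 ≤ A₁) (hr₁ : 0 ≤ r₁)
    (hrate : r₁ + 2 * (64 * Real.log 162) + 2 ≤ Rkp)
    (hsmall : (A₀ + ϱ * A₁) * Real.exp (5 * r₁ + 1) * K₀ 64 8 * 9 * 64 ≤ 1)
    (bondsOf : Finset (TPt 4 (L * N')) → Finset Bnd) {δ κ α₆ Rk b₀ s t : ℝ}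
    (hα₆ : 0 ≤ α₆) (hκk : 64 * Real.log 162 + 1 ≤ δ * κ) (h229k : Real.exp 1 * K₀ 64 8 * 64 * α₆ ≤ 1)
    (hs0 : 0 ≤ s) (hs1 : s ≤ 1) (ht : 0 ≤ t) (hb₀ : ∀ W, ((bondsOf W).card : ℝ) ≤ b₀ * W.card)
    {ε r R v : ℝ} (hε : 0 ≤ ε) (hv : 0 ≤ v)
    (hκR : 64 * Real.log 162 ≤ Rk - 64 * (Real.exp (Rk * 5) * s * Real.exp (b₀ * t)))
    (hrate2 : r + R ≤ (Rk - 64 * (Real.exp (Rk * 5) * s * Real.exp (b₀ * t)) - 64 * Real.log 162) * ((L : ℝ) / a236 L))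
    (hκ : 64 * Real.log 162 + 1 ≤ r)
    (h229 : Real.exp 1 * K₀ 64 8 * 64 *
      (ε * Real.exp (64 * (Real.exp (Rk * 5) * s * Real.exp (b₀ * t)) - 5 * Rk) * ((3 : ℝ) ^ 4 * (L : ℝ) ^ 4) * K₀ 64 8 *
          Real.exp (5 * R) *
        Real.exp (ε * Real.exp (64 * (Real.exp (Rk * 5) * s * Real.exp (b₀ * t)) - 5 * Rk) * ((3 : ℝ) ^ 4 * (L : ℝ) ^ 4) *
          K₀ 64 8)) ≤ 1)
    (hRR : Rkp ≤ R - 64 * (v * Real.exp (R * 5)))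
    (hadm : ∀ Z : (tsys 4 N').Dom, ∀ l ∈ terms Z, l.1 ⊆ Z.1 ∧
      l.2.1 ∈ coveringFamilies Finset.univ (fun Y : (tsys 4 N').Dom => Y.1) (Z.1 \ l.1) ∧
      ∀ Z' (h : Z' ∈ l.2.1), (l.2.2 Z' h).Nonempty ∧
        l.2.2 Z' h ⊆
          ((Finset.univ : Finset (tsys 4 (L * N')).Dom).filter (fun Z₀ => tclosureDom L N' Z₀ = Z')).sigma fun Z₀ =>
            Z₀.1.powerset.sigma fun W =>
              coveringFamilies Finset.univ (fun Y : (tsys 4 (L * N')).Dom => Y.1) (Z₀.1 \ W) ×ˢ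
                (bondsOf W).powerset.filter fun P => W.card ≤ 2 * P.card)
    (hAmp : ∀ Z : (tsys 4 N').Dom, Z.1 ⊆ X₀.1 → ∀ l ∈ terms Z,
      (𝔊 k l (emb Z)).lam.real univ * ((𝔊 k l (emb Z)).wB * N₀ k l (emb Z) * Real.exp (bq k l (emb Z))) *
          (Real.pi / (mq k l (emb Z) / 2)) ^ (Module.finrank ℝ (α k l) / 2 : ℝ) *
        Real.exp ((𝔊 k l (emb Z)).N₁ * (‖h₀‖ + ϱ * ‖w‖)) ≤
      (A₀ + ϱ * A₁) * (v ^ l.1.card * ∏ x ∈ l.2.1.attach, ∏ j ∈ l.2.2 x.1 x.2, (ε *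
        ((∏ Y ∈ j.2.2.1, (α₆ * Real.exp (-(δ * κ * torusTreeLen Y.1)) * Real.exp (-(Rk * (torusTreeLen Y.1 + 5))))) *
          (s ^ 2 * t) ^ j.2.2.2.card))))
    (hϱ : 2 ≤ ϱ) (hϱA : A₀ ≤ ϱ * A₁) :
    ‖locE (TTouch (d := 4) (N := N')) (fun Z : (tsys 4 N').Dom => Z.1) (act 1) X₀.1 -
        locE (TTouch (d := 4) (N := N')) (fun Z : (tsys 4 N').Dom => Z.1) (act 0) X₀.1‖ ≤
      4 * (Real.exp 1 * 9 * 64 * K₀ 64 8 ^ 2) * A₁ * Real.exp (-(r₁ * torusTreeLen X₀.1)) := by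
  obtain ⟨hν, hκ₀, hc⟩ := torus_consts N'
  obtain ⟨-, hκ₀k, hck⟩ := torus_consts (L * N')
  have hK₀ := K₀_four (N := N')
  have hK₀k := K₀_four (N := L * N')
  have htr := ineq236With_torus (d := 4) L N' hL
  have h := attachedPart_locE_le_of_coresAt_pencil_componentSets_inner (tsys 4 N') (tgeometry 4 N')
    (tgeometry 4 (L * N')) 𝔊 hroom hm hN hq hg hO hH hscale hact (Rkp := Rkp) (b₅ := 5 * r₁) (X₀ := X₀) hA₀ hA₁ hr₁
    (le_of_eq (by ring)) (by rw [hκ₀]; exact hrate) (by rw [hK₀, hν, hc]; exact hsmall) bondsOf (c₃₂ := 5) hα₆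
    (by rw [hκ₀k]; exact hκk) (by rw [hK₀k, hck]; exact h229k) hs0 hs1 ht hb₀
    (fun Z₀ W hW Df hDf => link_torus 4 (L * N') Z₀ W hW Df hDf) (tclosureDom L N')
    (fun Z' => Finset.univ.filter fun a : TPt 4 (L * N') =>
      ∃ y ∈ block (natLift a), proj N' (coarse L y) = Classical.choose Z'.2.1)
    (Aₐ := (3 : ℝ) ^ 4 * (L : ℝ) ^ 4) (ℓ := (L : ℝ) / a236 L) (c' := 5) hε hv
    (fun Z₀ Z' h => by subst h; exact exists_mem_anchor_choose Z₀)
    (fun Z' => card_anchor_choose_le (d := 4) (L := L) Z')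
    (fun Z₀ Z' h => by subst h; exact htr Z₀) (by rw [hκ₀k, hck]; exact hκR) (by rw [hκ₀k, hck]; exact hrate2)
    (by rw [hκ₀]; exact hκ) (by rw [hK₀, hc, hK₀k, hck]; exact h229) (fun Z W hW F hF => link_torus' 4 N' Z W hW F hF)
    (by rw [hc]; exact hRR) hadm hAmp hϱ hϱA
  rw [hν, hc, hK₀] at h
  exact h

end Sets

end End

end Summit.QuantumFields.BalabanUV.T4Continuum.NE1p.DressedSmallFieldComponentInnerNestedTori

end
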